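import Summits.FinalStateConjecture.FinalStateConjecture.Theorems.EIHFluxBalanceInertialRecessionPullback
import Summits.FinalStateConjecture.FinalStateConjecture.Theorems.EIHFluxBalanceInertialRecessionChartCalculus

/-!
# Route EIHFluxBalance — `InertialRecession`, re-charting: transporting a hole chart by the final boost

Helper file for the crux `stmt-FinalStateConjecture-10166`
(`Summit.FinalStateConjecture.FinalStateConjecture.Theses.EIHFluxBalance.InertialRecession`),
line `sublinear-is-free-clean-window-charges`, stub `stub_rechart` (the transfer P2), part G1.

The hole charts of the sought `FinalStateDecomposition` live on the BOOSTED exteriors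
`boostedKerrExterior Λ∞ 0 M a` of the final motions, while the clock/honest chart of a hole is
constructed in its REST frame, on `boostedKerrExterior 1 0 M a = Kerr.exterior M a`. This file
transports a rest-frame chart `Ψ₁` to the boosted exterior, `Ψ(x) = Ψ₁(Λ∞⁻¹ x)`, and shows that
near-zone `C^k` convergence transfers:
* `deviationExtend_boostTransport` — `(Ψ^* g − g_{Λ∞})(x) = (Ψ₁^* g − g_{M,a})(Λ∞⁻¹x)[Λ∞⁻¹·, Λ∞⁻¹·]`
  (re-charting identity of `…Pullback` along the linear map `Λ∞⁻¹`; the model defect vanishes);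
* `norm_iteratedFDeriv_precomp_bilinearComp_le` — `‖Dᵐ (x ↦ Z(Lx)[L·,L·])(x)‖ ≤ ‖L‖^{m+2} ‖Dᵐ Z(Lx)‖`;
* `truncDeviationCk_boostTransport_le`, `tendsto_truncDeviationCk_boostTransport` — the truncated
  slabs correspond under `Λ∞⁻¹`, so `truncDeviationCk` is multiplied by at most `max(1,‖Λ∞⁻¹‖)^{k+2}`
  and its decay transfers. [folklore]
-/

noncomputable section

set_option linter.dupNamespace false

open Set Filter Function Metric Topology
open scoped ContDiff Manifold ENNReal
open Literature.Geometry.Lorentzian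

namespace Summit.FinalStateConjecture.FinalStateConjecture.Theorems.SublinearIsFree.Rechart

/-! ### Pre-composition of a form field with a fixed linear map -/

/-- **`Cᵐ` estimate of a linearly transported form field**: for `Z` smooth on an open set `s ∋ L x`,
`‖Dᵐ (x ↦ Z(Lx)[L·, L·])(x)‖ ≤ ‖L‖^{m+2} ‖Dᵐ Z (Lx)‖`. [folklore] -/
theorem norm_iteratedFDeriv_precomp_bilinearComp_le {Z : E4 → E4 →L[ℝ] E4 →L[ℝ] ℝ} {s : Set E4}
    (hs : IsOpen s) (L : E4 ≃L[ℝ] E4) {x : E4} (hx : L x ∈ s) (hZ : ContDiffOn ℝ ∞ Z s) (m : ℕ) :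
    ‖iteratedFDeriv ℝ m (fun y ↦ (Z (L y)).bilinearComp (L : E4 →L[ℝ] E4) (L : E4 →L[ℝ] E4)) x‖ ≤
      ‖(L : E4 →L[ℝ] E4)‖ ^ (m + 2) * ‖iteratedFDeriv ℝ m Z (L x)‖ := by
  set Lc : E4 →L[ℝ] E4 := (L : E4 →L[ℝ] E4) with hLc
  have hZat : ContDiffAt ℝ ∞ Z (L x) := (hZ (L x) hx).contDiffAt (hs.mem_nhds hx)
  -- smoothness of the transported field at `x`
  have hG : ContDiffAt ℝ m (fun y ↦ (Z (L y)).bilinearComp Lc Lc) x := by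
    have h1 : ContDiffAt ℝ ∞ (fun y ↦ Z (L y)) x := hZat.comp x L.contDiff.contDiffAt
    exact ((contDiffWithinAt_bilinearComp_self (s := univ) h1.contDiffWithinAt
      contDiffWithinAt_const).contDiffAt univ_mem).of_le (by exact_mod_cast le_top)
  refine norm_iteratedFDeriv_le_of_forall_apply₂ hG (by positivity) fun v w ↦ ?_
  -- slot-wise: `y ↦ Z (L y) (L v) (L w) = (z ↦ Z z (Lv) (Lw)) ∘ L`
  have hfun : (fun y ↦ (Z (L y)).bilinearComp Lc Lc v w) = (fun z ↦ Z z (Lc v) (Lc w)) ∘ L := by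
    funext y; simp [hLc, ContinuousLinearMap.bilinearComp_apply]
  rw [hfun]
  have hpre : L ⁻¹' s ∈ 𝓝 x := (hs.preimage L.continuous).mem_nhds hx
  have hcomp := L.iteratedFDerivWithin_comp_right (fun z ↦ Z z (Lc v) (Lc w)) hs.uniqueDiffOn hx m
  rw [iteratedFDerivWithin_of_isOpen m (hs.preimage L.continuous) hx,
    iteratedFDerivWithin_of_isOpen m hs hx] at hcomp
  rw [hcomp]
  refine (ContinuousMultilinearMap.norm_compContinuousLinearMap_le _ _).trans ?_
  rw [Finset.prod_const, Finset.card_univ, Fintype.card_fin]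
  -- the slot function: two applications of a constant vector
  have hslot : ‖iteratedFDeriv ℝ m (fun z ↦ Z z (Lc v) (Lc w)) (L x)‖ ≤
      ‖Lc w‖ * (‖Lc v‖ * ‖iteratedFDeriv ℝ m Z (L x)‖) := by
    have h1 : ContDiffAt ℝ m (fun z ↦ Z z (Lc v)) (L x) :=
      (hZat.clm_apply contDiffAt_const).of_le (by exact_mod_cast le_top)
    refine (norm_iteratedFDeriv_clm_apply_const h1 le_rfl).trans ?_
    refine mul_le_mul_of_nonneg_left ?_ (norm_nonneg _)
    exact norm_iteratedFDeriv_clm_apply_const (hZat.of_le (by exact_mod_cast le_top)) le_rfl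
  have hv : ‖Lc v‖ ≤ ‖Lc‖ * ‖v‖ := Lc.le_opNorm v
  have hw : ‖Lc w‖ ≤ ‖Lc‖ * ‖w‖ := Lc.le_opNorm w
  have hD0 : 0 ≤ ‖iteratedFDeriv ℝ m Z (L x)‖ := norm_nonneg _
  calc ‖iteratedFDeriv ℝ m (fun z ↦ Z z (Lc v) (Lc w)) (L x)‖ * ‖(L : E4 →L[ℝ] E4)‖ ^ m
      ≤ ‖Lc w‖ * (‖Lc v‖ * ‖iteratedFDeriv ℝ m Z (L x)‖) * ‖Lc‖ ^ m :=
        mul_le_mul_of_nonneg_right hslot (by positivity)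
    _ ≤ (‖Lc‖ * ‖w‖) * ((‖Lc‖ * ‖v‖) * ‖iteratedFDeriv ℝ m Z (L x)‖) * ‖Lc‖ ^ m := by
        gcongr
    _ = ‖Lc‖ ^ (m + 2) * ‖iteratedFDeriv ℝ m Z (L x)‖ * ‖v‖ * ‖w‖ := by ring

/-! ### The boosted chart -/

section Boost

variable {𝓢 : Spacetime 4} (Λ : lorentzGroup) (M a : ℝ)
  (Ψ₁ : boostedKerrExterior 1 0 M a → 𝓢.carrier)

/-- Membership dictionary: `x` is in the boosted exterior iff `Λ⁻¹ x` is in the rest exterior.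
[folklore] -/
theorem symm_mem_boostedKerrExterior_one {x : E4} (hx : x ∈ boostedKerrExterior Λ 0 M a) :
    (Λ : E4 ≃L[ℝ] E4).symm x ∈ boostedKerrExterior 1 0 M a := by
  rw [mem_boostedKerrExterior, poincareInv_one, sub_zero]
  rwa [mem_boostedKerrExterior, poincareInv, sub_zero] at hx

/-- Converse membership dictionary. [folklore] -/
theorem mem_boostedKerrExterior_of_symm {x : E4}
    (hx : (Λ : E4 ≃L[ℝ] E4).symm x ∈ boostedKerrExterior 1 0 M a) : x ∈ boostedKerrExterior Λ 0 M a := by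
  rw [mem_boostedKerrExterior, poincareInv, sub_zero]
  rwa [mem_boostedKerrExterior, poincareInv_one, sub_zero] at hx

/-- **The boosted chart** `Ψ(x) = Ψ₁(Λ⁻¹ x)` on `boostedKerrExterior Λ 0 M a`. [folklore] -/
def boostChart (x : boostedKerrExterior Λ 0 M a) : 𝓢.carrier :=
  Ψ₁ ⟨(Λ : E4 ≃L[ℝ] E4).symm x.1, symm_mem_boostedKerrExterior_one Λ M a x.2⟩

/-- Unfolding lemma for `boostChart`. [folklore] -/
theorem boostChart_apply (x : boostedKerrExterior Λ 0 M a) : boostChart Λ M a Ψ₁ x =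
    Ψ₁ ⟨(fun y : E4 ↦ ((Λ : E4 ≃L[ℝ] E4).symm : E4 →L[ℝ] E4) y) x.1,
      symm_mem_boostedKerrExterior_one Λ M a x.2⟩ := rfl

/-- The model defect of the linear re-charting vanishes:
`g_{M,a}(Λ⁻¹x)[Λ⁻¹·,Λ⁻¹·] = boostedKerrBilin Λ 0 M a x`. [folklore] -/
theorem kerr_bilinearComp_symm_eq (x : E4) :
    (Kerr.bilin M a ((Λ : E4 ≃L[ℝ] E4).symm x)).bilinearComp (((Λ : E4 ≃L[ℝ] E4).symm : E4 →L[ℝ] E4))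
      (((Λ : E4 ≃L[ℝ] E4).symm : E4 →L[ℝ] E4)) = boostedKerrBilin Λ 0 M a x := by
  refine ContinuousLinearMap.ext fun v ↦ ContinuousLinearMap.ext fun w ↦ ?_
  rw [ContinuousLinearMap.bilinearComp_apply, boostedKerrBilin_apply, poincareInv, sub_zero]
  rfl

/-- **Re-charting identity for the boosted chart**:
`(Ψ^* g − g_Λ)(x) = (Ψ₁^* g − g_{M,a})(Λ⁻¹ x)[Λ⁻¹·, Λ⁻¹·]` on all of `E4` (both sides vanish off
the domains, which correspond under `Λ⁻¹`). [folklore] -/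
theorem deviationExtend_boostTransport (hΨ₁ : ContMDiff 𝓘(ℝ, E4) (𝓡 4) ∞ Ψ₁) (x : E4) :
    𝓢.deviationExtend (boostedKerrBackground Λ 0 M a) (boostChart Λ M a Ψ₁) x =
      (𝓢.deviationExtend (boostedKerrBackground 1 0 M a) Ψ₁ ((Λ : E4 ≃L[ℝ] E4).symm x)).bilinearComp
        (((Λ : E4 ≃L[ℝ] E4).symm : E4 →L[ℝ] E4)) (((Λ : E4 ≃L[ℝ] E4).symm : E4 →L[ℝ] E4)) := by
  set L : E4 →L[ℝ] E4 := ((Λ : E4 ≃L[ℝ] E4).symm : E4 →L[ℝ] E4) with hL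
  by_cases hx : x ∈ boostedKerrExterior Λ 0 M a
  · have hf : ContDiff ℝ ∞ (fun y : E4 ↦ L y) := L.contDiff
    have hK : ∀ y ∈ (boostedKerrBackground Λ 0 M a).domain,
        (fun y : E4 ↦ L y) y ∈ (boostedKerrBackground 1 0 M a).domain := fun y hy ↦
      symm_mem_boostedKerrExterior_one Λ M a hy
    have hid := deviation_comp_smooth' (𝓢 := 𝓢) (boostedKerrBackground 1 0 M a)
      (boostedKerrBackground Λ 0 M a) (f := fun y : E4 ↦ L y) hf hK (Φ := Ψ₁)
      (Ψ := boostChart Λ M a Ψ₁) (fun y ↦ rfl) hΨ₁ ⟨x, hx⟩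
    rw [show 𝓢.deviationExtend (boostedKerrBackground Λ 0 M a) (boostChart Λ M a Ψ₁) x =
      𝓢.deviation (boostedKerrBackground Λ 0 M a) (boostChart Λ M a Ψ₁) ⟨x, hx⟩ from
      𝓢.deviationExtend_coe _ _ ⟨x, hx⟩, hid, L.fderiv,
      show 𝓢.deviationExtend (boostedKerrBackground 1 0 M a) Ψ₁ ((Λ : E4 ≃L[ℝ] E4).symm x) =
        𝓢.deviation (boostedKerrBackground 1 0 M a) Ψ₁ ⟨L x, hK x hx⟩ from
        𝓢.deviationExtend_coe _ _ ⟨L x, hK x hx⟩]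
    have hzero : ((boostedKerrBackground 1 0 M a).bilin (L x)).bilinearComp L L -
        (boostedKerrBackground Λ 0 M a).bilin x = 0 := by
      rw [sub_eq_zero]
      show (boostedKerrBilin 1 0 M a (L x)).bilinearComp L L = boostedKerrBilin Λ 0 M a x
      rw [boostedKerrBilin_one_zero, hL]
      exact kerr_bilinearComp_symm_eq Λ M a x
    rw [hzero, add_zero]
  · have hx' : (Λ : E4 ≃L[ℝ] E4).symm x ∉ boostedKerrExterior 1 0 M a := fun h ↦
      hx (mem_boostedKerrExterior_of_symm Λ M a h)
    rw [𝓢.deviationExtend_of_not_mem (boostedKerrBackground Λ 0 M a) (boostChart Λ M a Ψ₁)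
        (show x ∉ (boostedKerrBackground Λ 0 M a).domain from hx),
      𝓢.deviationExtend_of_not_mem (boostedKerrBackground 1 0 M a) Ψ₁
        (show (Λ : E4 ≃L[ℝ] E4).symm x ∉ (boostedKerrBackground 1 0 M a).domain from hx')]
    refine ContinuousLinearMap.ext fun v ↦ ContinuousLinearMap.ext fun w ↦ ?_
    simp

/-- The rest-frame deviation is smooth on the rest exterior (the Kerr–Schild form is smooth off
the ring, and `r > r₊ ≥ 0` there for `0 ≤ M`, `|a| ≤ M`). [folklore] -/
theorem contDiffOn_deviationExtend_rest (hΨ₁ : ContMDiff 𝓘(ℝ, E4) (𝓡 4) ∞ Ψ₁) :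
    ContDiffOn ℝ ∞ (𝓢.deviationExtend (boostedKerrBackground 1 0 M a) Ψ₁)
      (boostedKerrExterior 1 0 M a : Set E4) := fun y hy ↦ by
  have hr : 0 < Kerr.radius a y := by
    have h := hy
    rw [SetLike.mem_coe, mem_boostedKerrExterior, poincareInv_one, sub_zero, Kerr.mem_exterior] at h
    exact (le_max_right _ _).trans_lt h
  have hb : ContDiffAt ℝ ∞ (boostedKerrBackground 1 0 M a).bilin y := by
    show ContDiffAt ℝ ∞ (boostedKerrBilin 1 0 M a) y
    have : boostedKerrBilin 1 0 M a = Kerr.bilin M a := funext fun z ↦ boostedKerrBilin_one_zero M a z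
    rw [this]
    exact Kerr.contDiffAt_bilin M a hr
  exact (contDiffAt_deviationExtend_of_bilin (𝓢 := 𝓢) (boostedKerrBackground 1 0 M a) hΨ₁ ⟨y, hy⟩
    hb).contDiffWithinAt

/-- **Pointwise transport bound**: at a point of the boosted exterior,
`‖Dᵐ (Ψ^* g − g_Λ)(x)‖ ≤ ‖Λ⁻¹‖^{m+2} ‖Dᵐ (Ψ₁^* g − g_{M,a})(Λ⁻¹x)‖`. [folklore] -/
theorem norm_iteratedFDeriv_deviationExtend_boostTransport_le (hΨ₁ : ContMDiff 𝓘(ℝ, E4) (𝓡 4) ∞ Ψ₁)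
    {x : E4} (hx : x ∈ boostedKerrExterior Λ 0 M a) (m : ℕ) :
    ‖iteratedFDeriv ℝ m (𝓢.deviationExtend (boostedKerrBackground Λ 0 M a) (boostChart Λ M a Ψ₁)) x‖ ≤
      ‖(((Λ : E4 ≃L[ℝ] E4).symm : E4 →L[ℝ] E4))‖ ^ (m + 2) *
        ‖iteratedFDeriv ℝ m (𝓢.deviationExtend (boostedKerrBackground 1 0 M a) Ψ₁)
          ((Λ : E4 ≃L[ℝ] E4).symm x)‖ := by
  have hfun : 𝓢.deviationExtend (boostedKerrBackground Λ 0 M a) (boostChart Λ M a Ψ₁) =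
      fun y ↦ (𝓢.deviationExtend (boostedKerrBackground 1 0 M a) Ψ₁ ((Λ : E4 ≃L[ℝ] E4).symm y)).bilinearComp
        (((Λ : E4 ≃L[ℝ] E4).symm : E4 →L[ℝ] E4)) (((Λ : E4 ≃L[ℝ] E4).symm : E4 →L[ℝ] E4)) :=
    funext (deviationExtend_boostTransport Λ M a Ψ₁ hΨ₁)
  rw [hfun]
  exact norm_iteratedFDeriv_precomp_bilinearComp_le (boostedKerrExterior 1 0 M a).isOpen
    (Λ : E4 ≃L[ℝ] E4).symm (symm_mem_boostedKerrExterior_one Λ M a hx)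
    (contDiffOn_deviationExtend_rest M a Ψ₁ hΨ₁) m

/-- **Transport of the truncated deviation**:
`truncDeviationCk (boosted) Ψ k R τ ≤ max(1, ‖Λ⁻¹‖)^{k+2} · truncDeviationCk (rest) Ψ₁ k R τ`
(the truncated slabs correspond under `Λ⁻¹`). [folklore] -/
theorem truncDeviationCk_boostTransport_le (hΨ₁ : ContMDiff 𝓘(ℝ, E4) (𝓡 4) ∞ Ψ₁) (k : ℕ) (R τ : ℝ) :
    𝓢.truncDeviationCk (boostedKerrBackground Λ 0 M a) (boostChart Λ M a Ψ₁) k R τ ≤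
      ENNReal.ofReal (max 1 ‖(((Λ : E4 ≃L[ℝ] E4).symm : E4 →L[ℝ] E4))‖ ^ (k + 2)) *
        𝓢.truncDeviationCk (boostedKerrBackground 1 0 M a) Ψ₁ k R τ := by
  set C : ℝ := max 1 ‖(((Λ : E4 ≃L[ℝ] E4).symm : E4 →L[ℝ] E4))‖ with hC
  have hC1 : 1 ≤ C := le_max_left _ _
  unfold Spacetime.truncDeviationCk supCkENorm
  refine iSup₂_le fun m hm ↦ iSup₂_le fun x hx ↦ ?_
  obtain ⟨x', hx', rfl⟩ := hx
  have hmem : x'.1 ∈ boostedKerrExterior Λ 0 M a := x'.2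
  have hpt := norm_iteratedFDeriv_deviationExtend_boostTransport_le Λ M a Ψ₁ hΨ₁ hmem m
  -- the corresponding rest-frame slab point
  set y : E4 := (Λ : E4 ≃L[ℝ] E4).symm x'.1 with hy
  have hy' : y ∈ Subtype.val '' (boostedKerrBackground 1 0 M a).truncTimeSlab R τ := by
    refine ⟨⟨y, symm_mem_boostedKerrExterior_one Λ M a hmem⟩, ?_, rfl⟩
    rw [ModelBackground.mem_truncTimeSlab] at hx' ⊢
    have hp : poincareInv 1 0 y = poincareInv Λ 0 x'.1 := by
      rw [poincareInv_one, sub_zero, hy, poincareInv, sub_zero]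
    have h1 : (boostedKerrBackground 1 0 M a).time y = (boostedKerrBackground Λ 0 M a).time x'.1 := by
      show (poincareInv 1 0 y) 0 = (poincareInv Λ 0 x'.1) 0
      rw [hp]
    have h2 : (boostedKerrBackground 1 0 M a).radius y = (boostedKerrBackground Λ 0 M a).radius x'.1 := by
      show Kerr.radius a (poincareInv 1 0 y) = Kerr.radius a (poincareInv Λ 0 x'.1)
      rw [hp]
    rw [h1, h2]
    exact hx'
  have hsup : ‖iteratedFDeriv ℝ m (𝓢.deviationExtend (boostedKerrBackground 1 0 M a) Ψ₁) y‖ₑ ≤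
      ⨆ (m : ℕ) (_ : m ≤ k), ⨆ x ∈ Subtype.val '' (boostedKerrBackground 1 0 M a).truncTimeSlab R τ,
        ‖iteratedFDeriv ℝ m (𝓢.deviationExtend (boostedKerrBackground 1 0 M a) Ψ₁) x‖ₑ :=
    enorm_iteratedFDeriv_le_supCkENorm hm hy' _
  have hpow : ‖(((Λ : E4 ≃L[ℝ] E4).symm : E4 →L[ℝ] E4))‖ ^ (m + 2) ≤ C ^ (k + 2) :=
    (pow_le_pow_left₀ (norm_nonneg _) (le_max_right _ _) _).trans
      (pow_le_pow_right₀ hC1 (by omega))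
  calc ‖iteratedFDeriv ℝ m (𝓢.deviationExtend (boostedKerrBackground Λ 0 M a) (boostChart Λ M a Ψ₁)) x'.1‖ₑ
      ≤ ENNReal.ofReal (C ^ (k + 2) *
          ‖iteratedFDeriv ℝ m (𝓢.deviationExtend (boostedKerrBackground 1 0 M a) Ψ₁) y‖) := by
        rw [← ofReal_norm]
        exact ENNReal.ofReal_le_ofReal (hpt.trans (mul_le_mul_of_nonneg_right hpow (norm_nonneg _)))
    _ = ENNReal.ofReal (C ^ (k + 2)) *
          ‖iteratedFDeriv ℝ m (𝓢.deviationExtend (boostedKerrBackground 1 0 M a) Ψ₁) y‖ₑ := by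
        rw [ENNReal.ofReal_mul (by positivity), ofReal_norm]
    _ ≤ _ := mul_le_mul' le_rfl hsup

/-- **Near-zone convergence transfers to the boosted chart.** [folklore] -/
theorem tendsto_truncDeviationCk_boostTransport (hΨ₁ : ContMDiff 𝓘(ℝ, E4) (𝓡 4) ∞ Ψ₁) (k : ℕ) (R : ℝ)
    (h : Tendsto (fun τ ↦ 𝓢.truncDeviationCk (boostedKerrBackground 1 0 M a) Ψ₁ k R τ) atTop (𝓝 0)) :
    Tendsto (fun τ ↦ 𝓢.truncDeviationCk (boostedKerrBackground Λ 0 M a) (boostChart Λ M a Ψ₁) k R τ)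
      atTop (𝓝 0) := by
  set c : ℝ≥0∞ := ENNReal.ofReal (max 1 ‖(((Λ : E4 ≃L[ℝ] E4).symm : E4 →L[ℝ] E4))‖ ^ (k + 2)) with hc
  have hlim : Tendsto (fun τ ↦ c * 𝓢.truncDeviationCk (boostedKerrBackground 1 0 M a) Ψ₁ k R τ)
      atTop (𝓝 0) := by
    have := ENNReal.Tendsto.const_mul (a := c) h (Or.inr (by rw [hc]; exact ENNReal.ofReal_ne_top))
    rwa [mul_zero] at this
  exact tendsto_of_tendsto_of_tendsto_of_le_of_le tendsto_const_nhds hlim (fun _ ↦ bot_le)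
    fun τ ↦ truncDeviationCk_boostTransport_le Λ M a Ψ₁ hΨ₁ k R τ

end Boost

/-- Registered one-line form (worker carrier `rechart_kerr_bilinearComp_symm_eq`). [folklore] -/
theorem rechart_kerr_bilinearComp_symm_eq : open Literature.Geometry.Lorentzian in ∀ (Λ : lorentzGroup) (M a : ℝ) (x : E4), (Kerr.bilin M a ((Λ : E4 ≃L[ℝ] E4).symm x)).bilinearComp (((Λ : E4 ≃L[ℝ] E4).symm : E4 →L[ℝ] E4)) (((Λ : E4 ≃L[ℝ] E4).symm : E4 →L[ℝ] E4)) = boostedKerrBilin Λ 0 M a x := kerr_bilinearComp_symm_eq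

end Summit.FinalStateConjecture.FinalStateConjecture.Theorems.SublinearIsFree.Rechart

end
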